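import Summits.QuantumFields.YangMills.Theorems.HypercubicLimit.Negative.NonabelianLoadBearing
import Summits.QuantumFields.YangMills.Theorems.MirrorModularBoostsHypercubicLimitPlaneLimitsDefs
import Summits.QuantumFields.YangMills.Theorems.MirrorModularBoostsHypercubicLimitClosureHalvesDefs
import Summits.QuantumFields.YangMills.Theorems.PencilRigidityDiagonalMirrorRPRStubRpClosureDefs
import Summits.QuantumFields.YangMills.Theorems.PencilRigidityCurvatureChannel

/-!
# Negative knowledge on D1 `stub_diagRPOfPlaneLimits` of crux `WeakCouplingHypercubicLimitRP` (stmt-QuantumFields-27398), II: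
# the junk gauge group is harmless

D1 (registered skeleton `Cruxes/WeakCouplingHypercubicLimitRP/Lines/Sketch.lean`, l.1618): for every compact gauge group `G`,
`LatticeRep r`, scheme `sch`, subsequence `φ` and plane-limit family `T`,
`HasWeakCouplingLimit → PolyVolume → PolyRenorm → UniformFunctionalBoundPlanes → (∃ Δ C, 0 < Δ ∧ RPSpectral r sch Δ C) →
PlaneLimits r sch φ T → DiagonalFrameRP (planeSum T)`.
D1 carries no `IsCompactSimpleLieGroup G` hypothesis (the heart S6i does), so `G = PUnit` is an admissible instance. It is NO
counterexample — `diagonalFrameRP_planeSum_of_subsingleton`: for every one-element gauge group, every `LatticeRep`, scheme, `φ`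
and `T` with `PlaneLimits`, `DiagonalFrameRP (planeSum T)` holds. Mechanism: at a one-element group the torus weights are
deterministic, `∑_q planeDist_k(n, q) = W_kⁿ · D_k` with `D_k(F) = ∑ F(a_k x)` over strings `x` of box sites, and the reflection
of a diagonal frame `R e₀ = a e₀ + b e₁` acts on the cubic lattice as the signed swap `(s₀,s₁,s₂,s₃) ↦ (τs₁, τs₀, s₂, s₃)`,
`τ = −2ab ∈ {±1}` (`timeReflection_frame_lattice`), whence `D_k(R^*(θF̄ ⊗ G)) = conj(D_k(R^*F)) · D_k(R^*G)`
(`latSum_linActMulti_appendTensor`): the lattice E2 form is a perfect square at every `k` and the limit inherits `re ≥ 0`,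
`im = 0` (standing disprover `cdisprove-27398-1`; work file `Cruxes/WeakCouplingHypercubicLimitRP/Disproof.lean`).
HONEST REGISTER: bookkeeping for the line only; nothing here bears on the mass gap.
-/

noncomputable section

open scoped SchwartzMap ComplexConjugate InnerProductSpace
open MeasureTheory Filter Topology Complex
open Literature.MathematicalPhysics.AQFT Literature.MathematicalPhysics.QuantumLattice
open Literature.MathematicalPhysics.QuantumFieldTheory
open Literature.Probability.LatticeModels (box Site mem_box)
open Summit.QuantumFields.YangMills.Cruxes.HypercubicLimit.CouplingResponse
open Summit.QuantumFields.YangMills.Cruxes.DiagonalMirrorRPR.ParityBridgeColdTraces (DiagonalFrameRP)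
open Summit.QuantumFields.YangMills.Theorems.OSLegsFromFemtoAndGap (latticeDistStr torusMomentStr
  latticeDistStr_apply)
open Summit.QuantumFields.YangMills.Theorems.HypercubicLimit.Negative (punitRep)
open Summit.QuantumFields.YangMills.Theorems.CurvatureChannel (isOffDiagonal_linActMulti_of_isAppendTensorOf)

namespace Summit.QuantumFields.YangMills.Theorems.WeakCouplingHypercubicLimitRP.Negative.DiagRPOfPlaneLimitsJunkGroup

section JunkGroup

variable {G : Type} [Group G] [TopologicalSpace G] [IsTopologicalGroup G] [CompactSpace G]
  [MeasurableSpace G] [BorelSpace G]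

/-- The scaled-lattice sum functional `D F = Σ_{x ∈ (box L)ⁿ} F(c x)`. [folklore] -/
def latSum (L : ℕ) (c : ℝ) (n : ℕ) (F : 𝓢((Fin n → EuclideanSpace ℝ (Fin 4)), ℂ)) : ℂ :=
  ∑ x ∈ Fintype.piFinset (fun _ : Fin n => box 4 L), F (fun i => c • siteToE (x i))

/-- For a one-element gauge group every torus weight is the deterministic product `∏ᵢ (Oᵢ(V₀) − mᵢ)`. [folklore] -/
theorem torusMomentStr_of_subsingleton [Subsingleton G] {N : ℕ} (ρ : G →* Matrix (Fin N) (Fin N) ℂ)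
    (hρ : Continuous ρ) (β : ℝ) (L : ℕ) {n : ℕ} (O : Fin n → LGConfig 4 G → ℝ) (m : Fin n → ℝ)
    (x : Fin n → Site 4) (V₀ : LGConfig 4 G) : torusMomentStr ρ β L O m x = ∏ i, (O i V₀ - m i) := by
  haveI := isProbabilityMeasure_wilsonMeasure (d := 4) (L := 2 * L + 1) ρ hρ β
  unfold torusMomentStr
  have hc : (fun U : GaugeConfig 4 (2 * L + 1) G =>
      ∏ i, (O i (configShift (-(x i)) (torusLift (2 * L + 1) U)) - m i)) = fun _ => ∏ i, (O i V₀ - m i) := by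
    funext U
    exact Finset.prod_congr rfl fun i _ => by rw [Subsingleton.elim (configShift (-(x i)) (torusLift (2 * L + 1) U)) V₀]
  rw [hc, integral_const, smul_eq_mul, probReal_univ, one_mul]

/-- The plane weight `w_k(p) = c_k a_k⁴ (F_p(V₀) − m_k/6)` of a one-element gauge group. [folklore] -/
def planeWeight (r : LatticeRep G) (sch : SpeciesScheme (YMSpecies G)) (k : ℕ) (V₀ : LGConfig 4 G) (p : Plane) : ℝ :=
  sch.c r.curvature k * sch.a k ^ 4 * ((planeSpecies r p).F V₀ - sch.m r.curvature k / 6)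

/-- `planeDist_k n q = (∏ᵢ w_k(qᵢ)) · D_k` for a one-element gauge group. [folklore] -/
theorem planeDist_of_subsingleton [Subsingleton G] (r : LatticeRep G) (sch : SpeciesScheme (YMSpecies G)) (k n : ℕ)
    (q : Fin n → Plane) (F : 𝓢((Fin n → EuclideanSpace ℝ (Fin 4)), ℂ)) (V₀ : LGConfig 4 G) :
    planeDist r sch k n q F = ((∏ i, planeWeight r sch k V₀ (q i) : ℝ) : ℂ) * latSum (sch.L k) (sch.a k) n F := by
  simp only [planeDist, latSum, _root_.smul_apply, latticeDistStr_apply, smul_eq_mul,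
    Finset.mul_sum, torusMomentStr_of_subsingleton r.ρ r.continuous _ _ _ _ _ V₀]
  refine Finset.sum_congr rfl fun x _ => ?_
  rw [← mul_assoc, ← Complex.ofReal_mul]
  congr 2
  simp only [planeWeight]
  rw [Finset.prod_mul_distrib, Finset.prod_const, Finset.card_univ, Fintype.card_fin]

/-- Summed over all strings: `Σ_q planeDist_k n q = W_kⁿ · D_k`, `W_k = Σ_p w_k(p)`. [folklore] -/
theorem sum_planeDist_of_subsingleton [Subsingleton G] (r : LatticeRep G) (sch : SpeciesScheme (YMSpecies G))
    (k n : ℕ) (F : 𝓢((Fin n → EuclideanSpace ℝ (Fin 4)), ℂ)) (V₀ : LGConfig 4 G) :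
    ∑ q : Fin n → Plane, planeDist r sch k n q F =
      (((∑ p : Plane, planeWeight r sch k V₀ p) ^ n : ℝ) : ℂ) * latSum (sch.L k) (sch.a k) n F := by
  simp only [planeDist_of_subsingleton r sch k n _ F V₀]
  rw [← Finset.sum_mul, Finset.sum_pow', Fintype.piFinset_univ]
  push_cast
  rfl

/-- The lattice signed swap `(s⁰, s¹, s², s³) ↦ (τ s¹, τ s⁰, s², s³)`. [folklore] -/
def sswap (τ : ℤ) (s : Site 4) : Site 4 := ![τ * s 1, τ * s 0, s 2, s 3]

omit [Group G] [TopologicalSpace G] [IsTopologicalGroup G] [CompactSpace G] [MeasurableSpace G] [BorelSpace G] in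
/-- The signed swap is an involution. [folklore] -/
theorem sswap_sswap {τ : ℤ} (hτ : τ = 1 ∨ τ = -1) (s : Site 4) : sswap τ (sswap τ s) = s := by
  funext i
  fin_cases i <;> rcases hτ with rfl | rfl <;> simp [sswap]

omit [Group G] [TopologicalSpace G] [IsTopologicalGroup G] [CompactSpace G] [MeasurableSpace G] [BorelSpace G] in
/-- The signed swap preserves the cubic box. [folklore] -/
theorem sswap_mem_box {τ : ℤ} (hτ : τ = 1 ∨ τ = -1) {L : ℕ} {s : Site 4} (hs : s ∈ box 4 L) : sswap τ s ∈ box 4 L := by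
  rw [mem_box] at hs ⊢
  have h0 := hs 0; have h1 := hs 1; have h2 := hs 2; have h3 := hs 3
  intro i
  fin_cases i <;> rcases hτ with rfl | rfl <;> simp [sswap] <;> omega

omit [Group G] [TopologicalSpace G] [IsTopologicalGroup G] [CompactSpace G] [MeasurableSpace G] [BorelSpace G] in
/-- Frame time for a general diagonal frame: `(R⁻¹ p)⁰ = ⟨p, R e₀⟩ = a p⁰ + b p¹`. [folklore] -/
theorem frame_time {R : EuclideanSpace ℝ (Fin 4) ≃ₗᵢ[ℝ] EuclideanSpace ℝ (Fin 4)} {a b : ℝ}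
    (hR : R (EuclideanSpace.single 0 1) = a • EuclideanSpace.single 0 1 + b • EuclideanSpace.single 1 1)
    (p : EuclideanSpace ℝ (Fin 4)) : (R.symm p) 0 = a * p 0 + b * p 1 := by
  -- adapted from `ParityBridgeColdTraces.frame_time` (Theorems/PencilRigidityDiagonalMirrorRPRStubRpClosureDefs)
  have h1 : (R.symm p) 0 = ⟪R.symm p, EuclideanSpace.single 0 (1 : ℝ)⟫_ℝ := by
    rw [EuclideanSpace.inner_single_right]; simp
  rw [h1, LinearIsometryEquiv.inner_map_eq_flip, LinearIsometryEquiv.symm_symm, hR, inner_add_right,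
    inner_smul_right, inner_smul_right, EuclideanSpace.inner_single_right, EuclideanSpace.inner_single_right]
  simp

omit [Group G] [TopologicalSpace G] [IsTopologicalGroup G] [CompactSpace G] [MeasurableSpace G] [BorelSpace G] in
/-- The sign `τ = −2ab ∈ {±1}` of a diagonal frame. [folklore] -/
theorem exists_frame_sign {a b : ℝ} (ha : a ^ 2 = 1 / 2) (hb : b ^ 2 = 1 / 2) :
    ∃ τ : ℤ, (τ = 1 ∨ τ = -1) ∧ (τ : ℝ) = -(2 * a * b) := by
  have h : (2 * a * b) ^ 2 = 1 := by rw [mul_pow, mul_pow, ha, hb]; norm_num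
  rcases sq_eq_one_iff.1 h with h1 | h1
  · exact ⟨-1, Or.inr rfl, by rw [h1]; norm_num⟩
  · exact ⟨1, Or.inl rfl, by rw [h1]; norm_num⟩

omit [Group G] [TopologicalSpace G] [IsTopologicalGroup G] [CompactSpace G] [MeasurableSpace G] [BorelSpace G] in
/-- **Frame reflection on the lattice**: `θ ∘ R⁻¹ = R⁻¹ ∘ (signed swap)` on scaled lattice points — the frame reflection
`R θ R⁻¹` across `(R e₀)^⊥` is the signed swap `x⁰ ↔ x¹` with sign `τ = −2ab`. [folklore] -/
theorem timeReflection_frame_lattice {R : EuclideanSpace ℝ (Fin 4) ≃ₗᵢ[ℝ] EuclideanSpace ℝ (Fin 4)} {a b : ℝ}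
    (ha : a ^ 2 = 1 / 2) (hb : b ^ 2 = 1 / 2)
    (hR : R (EuclideanSpace.single 0 1) = a • EuclideanSpace.single 0 1 + b • EuclideanSpace.single 1 1)
    {τ : ℤ} (hτ : (τ : ℝ) = -(2 * a * b)) (c : ℝ) (s : Site 4) :
    timeReflection 4 (R.symm (c • siteToE s)) = R.symm (c • siteToE (sswap τ s)) := by
  apply R.injective
  rw [LinearIsometryEquiv.apply_symm_apply,
    Summit.QuantumFields.YangMills.Cruxes.DiagonalMirrorRPR.ParityBridgeColdTraces.RpClosure.timeReflection_eq_sub, map_sub,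
    LinearIsometryEquiv.apply_symm_apply, frame_time hR, LinearIsometryEquiv.map_smul]
  rw [hR]
  ext i
  fin_cases i
  · simp [sswap, siteToE_apply]
    linear_combination (-(c * (s 1 : ℝ))) * hτ - (2 * c * (s 0 : ℝ)) * ha
  · simp [sswap, siteToE_apply]
    linear_combination (-(c * (s 0 : ℝ))) * hτ - (2 * c * (s 1 : ℝ)) * hb
  · simp [sswap, siteToE_apply]
  · simp [sswap, siteToE_apply]

omit [Group G] [TopologicalSpace G] [IsTopologicalGroup G] [CompactSpace G] [MeasurableSpace G] [BorelSpace G] in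
/-- The reindexing `y ↦ (signed swap) ∘ y ∘ rev` of lattice strings, an involution. [folklore] -/
def swapRevEquiv {τ : ℤ} (hτ : τ = 1 ∨ τ = -1) (n : ℕ) : (Fin n → Site 4) ≃ (Fin n → Site 4) where
  toFun y l := sswap τ (y (Fin.rev l))
  invFun y l := sswap τ (y (Fin.rev l))
  left_inv y := funext fun l => by simp only [Fin.rev_rev, sswap_sswap hτ]
  right_inv y := funext fun l => by simp only [Fin.rev_rev, sswap_sswap hτ]

omit [Group G] [TopologicalSpace G] [IsTopologicalGroup G] [CompactSpace G] [MeasurableSpace G] [BorelSpace G] in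
/-- **The lattice E2 term in a diagonal frame factorises**: `D(R^*(θF* ⊗ G)) = conj(D(R^*F)) · D(R^*G)`, because the
frame reflection is a signed swap of the cubic box. [folklore] -/
theorem latSum_linActMulti_appendTensor {R : EuclideanSpace ℝ (Fin 4) ≃ₗᵢ[ℝ] EuclideanSpace ℝ (Fin 4)} {a b : ℝ}
    (ha : a ^ 2 = 1 / 2) (hb : b ^ 2 = 1 / 2)
    (hR : R (EuclideanSpace.single 0 1) = a • EuclideanSpace.single 0 1 + b • EuclideanSpace.single 1 1)
    (L : ℕ) (c : ℝ) {n m : ℕ} {F : 𝓢((Fin n → EuclideanSpace ℝ (Fin 4)), ℂ)}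
    {G' : 𝓢((Fin m → EuclideanSpace ℝ (Fin 4)), ℂ)} {H : 𝓢((Fin (n + m) → EuclideanSpace ℝ (Fin 4)), ℂ)}
    (hH : IsAppendTensorOf H (osAdjoint F) G') :
    latSum L c (n + m) (linActMulti R H) = conj (latSum L c n (linActMulti R F)) * latSum L c m (linActMulti R G') := by
  obtain ⟨τ, hτ, hτr⟩ := exists_frame_sign ha hb
  unfold latSum
  simp only [linActMulti_apply]
  -- split the string sum `(box L)^{n+m} = (box L)^n × (box L)^m`
  have hsplit : ∑ x ∈ Fintype.piFinset (fun _ : Fin (n + m) => box 4 L), H (fun i => R.symm (c • siteToE (x i))) =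
      ∑ p ∈ Fintype.piFinset (fun _ : Fin n => box 4 L) ×ˢ Fintype.piFinset (fun _ : Fin m => box 4 L),
        H (fun i => R.symm (c • siteToE (Fin.append p.1 p.2 i))) := by
    refine (Finset.sum_equiv (Fin.appendEquiv n m) (fun p => ?_) (fun p _ => rfl)).symm
    simp only [Finset.mem_product, Fintype.mem_piFinset, Fin.appendEquiv_apply, Fin.forall_fin_add, Fin.append_left,
      Fin.append_right]
  rw [hsplit, Finset.sum_product]
  simp only [hH _, Function.comp_def, Fin.append_left, Fin.append_right]
  rw [← Finset.sum_mul_sum]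
  congr 1
  -- the reflected factor: reindex by the signed swap composed with reversal
  rw [map_sum]
  simp only [osAdjoint_apply, timeReflection_frame_lattice ha hb hR hτr]
  refine Finset.sum_equiv (swapRevEquiv hτ n) (fun y => ?_) (fun y _ => rfl)
  simp only [Fintype.mem_piFinset]
  constructor
  · intro hy l
    exact sswap_mem_box hτ (hy _)
  · intro hy l
    have h := sswap_mem_box hτ (hy (Fin.rev l))
    simpa only [swapRevEquiv, Equiv.coe_fn_mk, Fin.rev_rev, sswap_sswap hτ] using h

/-- **D1 HOLDS for every one-element gauge group** (every `LatticeRep`, every scheme, every `φ`, `T`; only the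
convergence clause `PlaneLimits.1` is used): the junk model `G = PUnit`, which D1 does not exclude, is no refutation. [folklore] -/
theorem diagonalFrameRP_planeSum_of_subsingleton [Subsingleton G] (r : LatticeRep G) (sch : SpeciesScheme (YMSpecies G))
    (φ : ℕ → ℕ) (T : (n : ℕ) → (Fin n → Plane) → (𝓢((Fin n → EuclideanSpace ℝ (Fin 4)), ℂ) →L[ℂ] ℂ))
    (hT : PlaneLimits r sch φ T) : DiagonalFrameRP (planeSum T) := by
  intro R a b ha hb hR N deg lab F hF H hH
  set V₀ : LGConfig 4 G := fun _ => 1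
  -- the lattice E2 form at step `k` is a perfect square
  have hk : ∀ k, ∑ i, ∑ j, ∑ q : Fin (deg i + deg j) → Plane, planeDist r sch k (deg i + deg j) q (linActMulti R (H i j)) =
      conj (∑ j, (((∑ p : Plane, planeWeight r sch k V₀ p) ^ deg j : ℝ) : ℂ) *
          latSum (sch.L k) (sch.a k) (deg j) (linActMulti R (F j))) *
        ∑ j, (((∑ p : Plane, planeWeight r sch k V₀ p) ^ deg j : ℝ) : ℂ) *
          latSum (sch.L k) (sch.a k) (deg j) (linActMulti R (F j)) := by
    intro k
    rw [map_sum, Finset.sum_mul_sum]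
    refine Finset.sum_congr rfl fun i _ => Finset.sum_congr rfl fun j _ => ?_
    rw [sum_planeDist_of_subsingleton r sch k _ _ V₀, latSum_linActMulti_appendTensor ha hb hR _ _ (hH i j), pow_add]
    simp only [map_mul, Complex.conj_ofReal]
    push_cast
    ring
  have hsq : ∀ k, 0 ≤ (∑ i, ∑ j, ∑ q : Fin (deg i + deg j) → Plane,
      planeDist r sch k (deg i + deg j) q (linActMulti R (H i j))).re ∧
      (∑ i, ∑ j, ∑ q : Fin (deg i + deg j) → Plane, planeDist r sch k (deg i + deg j) q (linActMulti R (H i j))).im = 0 := by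
    intro k
    rw [hk k, mul_comm, Complex.mul_conj, Complex.ofReal_re, Complex.ofReal_im]
    exact ⟨Complex.normSq_nonneg _, rfl⟩
  -- pass to the limit along `φ`
  have hlim : Tendsto (fun k => ∑ i, ∑ j, ∑ q : Fin (deg i + deg j) → Plane,
      planeDist r sch (φ k) (deg i + deg j) q (linActMulti R (H i j))) atTop
      (𝓝 (∑ i, ∑ j, planeSum T (deg i + deg j) (linActMulti R (H i j)))) :=
    tendsto_finsetSum _ fun i _ => tendsto_finsetSum _ fun j _ =>
      hT.tendsto_planeSum _ (isOffDiagonal_linActMulti_of_isAppendTensorOf R (hF i) (hF j) (hH i j))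
  have hterm : ∀ i j, (SchwingerFamily.toLabelled (fun n => (planeSum T n).comp (linActMulti R))) (deg i + deg j)
      (Fin.append (lab i ∘ Fin.rev) (lab j)) (H i j) = planeSum T (deg i + deg j) (linActMulti R (H i j)) := fun i j => by
    rw [SchwingerFamily.toLabelled_apply, ContinuousLinearMap.comp_apply]
  simp only [hterm]
  refine ⟨ge_of_tendsto' ((Complex.continuous_re.tendsto _).comp hlim) fun k => (hsq (φ k)).1, ?_⟩
  refine tendsto_nhds_unique ((Complex.continuous_im.tendsto _).comp hlim) ?_
  have h0 : (fun k => (∑ i, ∑ j, ∑ q : Fin (deg i + deg j) → Plane,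
      planeDist r sch (φ k) (deg i + deg j) q (linActMulti R (H i j))).im) = fun _ => 0 :=
    funext fun k => (hsq (φ k)).2
  rw [Function.comp_def, h0]
  exact tendsto_const_nhds

/-- **Corollary (the junk instance of D1, by name).** D1 holds at `G = PUnit` with all its hypotheses, whatever the scheme:
weakening `IsCompactSimpleLieGroup` away costs nothing here. [folklore] -/
theorem D1_at_punit [MeasurableSpace PUnit] [BorelSpace PUnit] (r : LatticeRep PUnit)
    (sch : SpeciesScheme (YMSpecies PUnit)) (φ : ℕ → ℕ)
    (T : (n : ℕ) → (Fin n → Plane) → (𝓢((Fin n → EuclideanSpace ℝ (Fin 4)), ℂ) →L[ℂ] ℂ))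
    (hT : PlaneLimits r sch φ T) : DiagonalFrameRP (planeSum T) :=
  diagonalFrameRP_planeSum_of_subsingleton r sch φ T hT

end JunkGroup

end Summit.QuantumFields.YangMills.Theorems.WeakCouplingHypercubicLimitRP.Negative.DiagRPOfPlaneLimitsJunkGroup
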